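/-
Copyright (c) 2026. All rights reserved.
Released under Apache 2.0 license as described in the file LICENSE.
Authors: abc-iut cell, seat abc-iut-w5-d169 (gen 16; row «PL2-LEAF-2», leaf (BAL) of programme P-L2).
-/
import Literature.AnabelianGeometry.EtaleTheta.SettingModelFoxLevelMaps
import Literature.GroupTheory.CombinatorialGroupTheory.GroupRingCyclicNorm
import Literature.GroupTheory.CombinatorialGroupTheory.FoxChainPushforward
import Mathlib.GroupTheory.GroupAction.Quotient
import Mathlib.GroupTheory.Coset.Card
import Mathlib.RingTheory.Ideal.Quotient.Basic
import Mathlib.RingTheory.Coprime.Lemmas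
import Mathlib.Tactic.LinearCombination
import HarnessLib

/-!
# Balanced Fox chains fix a `b`-vertex: the orbit criterion (a-balance ⇒ conjugacy into `⟨B⟩`)

Lyndon–Schupp, *Combinatorial Group Theory*, Ch. II §3 (Fox calculus read in a finite quotient `G` of the free
group `F(a,b)`: the chain `(α_w, β_w)` of a word satisfies the fundamental formula
`α_w (A - 1) + β_w (B - 1) = π(w) - 1` in `k[G]`) [cite: LyndonSchupp2001, Ch. II §3]; K. S. Brown, *Cohomology of
Groups*, Ch. I §6 (6.3) (`ker(N_q ·) = (1 - q) k[G]` for the norm element `N_q` of a cyclic group)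
[cite: Brown1982CohomologyGroups, Ch. I §6 (6.3)]; Mochizuki, *The étale theta function …* [EtTh] §1, PRIMS p. 12
(«`Δ_X` … a profinite free group on 2 generators» — OUR model `F̂₂ = F₂hatT` with the level Fox maps
`FoxLevel.lev / alpha / beta` of `SettingModelFoxLevelMaps.lean`, abc-iut-f-069) [cite: MochizukiEtTh2009, §1 p.12].

PROOF-ONLY file (no definition, no instance, no notation), abc-iut cell layer L6, seat abc-iut-w5-d169 (gen 16),
row PL2-LEAF-2 of abc-iut-L6-lead: leaf **(BAL)** of programme P-L2, rung (L2-T) — the (⇒) direction of the ORBIT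
CRITERION, Lemma 2′(⇒) of the cell's desk text PL2-SEP-PROOF-v2 (sha16 9791feedc2eba23e, «✓ desk, RE-READ ×3
CONCUR»), quoted verbatim: *«Let `w ∈ F`, `q := π(w)`, `Q := ⟨q⟩`. For a prime `ℓ` let `q_ℓ :=` the `ℓ`-primary part
of `q`. (⇒) If `w` is a-balanced at `N`, then `gcd{ |Q·v| : v ∈ G/⟨ȳ⟩ } = 1`; consequently, for EVERY prime `ℓ`,
`q_ℓ` fixes some b-vertex, i.e. `q_ℓ` is `G`-conjugate into `⟨ȳ⟩`.»*  Here, with coefficients in a finite (or any)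
commutative ring `k` instead of `Ẑ`: a-BALANCE at the level `(G, A, B)` is `N_q · α = 0` (`FoxChain.normL q α = 0`,
`q = π w`; for the level Fox chain of `w ∈ F̂₂` this is `α_{w ^ ord(π w)} = 0`, `FoxLevel.alpha_pow`), and the prime
`ℓ ∉ Ẑˣ` becomes ANY `ℓ : ℕ` that is NOT A UNIT of `k` (e.g. `k = ZMod ℓ^e`, `e ≥ 1`).

* MODEL-FREE CORE (namespace `FoxChain`, any finite group `G`, any `G`-set `X`): fibre sums `FoxChain.push p` along a
  `G`-equivariant map `p : G → X` turn left translation into translation of the fibre (`push_lt_apply_of_smul`) and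
  are blind to right translation by an element acting trivially on fibres (`push_rt_of_apply_mul`); a chain `θ` with
  `θ - q·θ = φ - φ·h` therefore pushes forward to a `q`-INVARIANT `k`-valued function on `X`
  (`push_apply_smul_eq_of_sub_lt_eq_sub_rt`).  From the fundamental formula (c2) and `α = γ - q·γ` (Brown (6.3),
  `FoxChain.normL_eq_zero_iff`) the chain `θ := e_1 + γ·A - γ` has `θ - q·θ = β - β·B` and total mass `1`
  (`sub_lt_eq_sub_rt_of_bd`, `sum_e_one_add_rt_sub`); on the `b`-vertices `X = G ⧸ ⟨B⟩` its push-forward `ξ` is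
  `q`-invariant of total mass `1`, so by the orbit-count vanishing test `FoxChain.sum_eq_zero_of_dvd_minimalPeriod`
  NOT every `⟨q⟩`-orbit has length divisible by `ℓ` — ★ `exists_conj_pow_mem_zpowers_of_normL_eq_zero`:
  `∃ g d, ¬ ℓ ∣ d ∧ g⁻¹ q^d g ∈ ⟨B⟩` (first for `(ℓ : k) = 0`, then for `ℓ ∉ kˣ` by base change to `k ⧸ (ℓ)`), and its
  primary-part form `exists_forall_conj_mem_zpowers_of_normL_eq_zero` (for `ℓ` prime ONE `g` conjugates every
  `ℓ`-power-order element of `⟨q⟩` — in particular `q_ℓ` — into `⟨B⟩`; Bezout, `mem_of_pow_mem_of_coprime`).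
* THE LEAF (BAL) AT A LEVEL OF `F̂₂` (namespace `SettingModel.FoxLevel`, (c2) = `FoxLevel.alpha_bd` BY NAME):
  ★ `exists_conj_lev_pow_mem_zpowers_of_normL_eq_zero` / `…_of_alpha_pow_eq_zero` (hypothesis
  `normL (lev A B w) (alpha A B w) = 0` ⟺ `alpha A B (w ^ orderOf (lev A B w)) = 0`), the primary-part spelling
  `exists_forall_eq_conj_pow_of_normL_eq_zero` («`x = g B^n g⁻¹`», the shape fed to
  `SettingModel.exists_eq_conj_bPow_of_forall_quotient` by Theorem A), and the `ZMod n` spelling (`ℓ ∣ n`, `1 < ℓ`).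
Classical finite group-ring / `G`-set algebra + statements about OUR semi-synthetic model; nothing of [EtTh] is
asserted; no side is taken on [IUTchIII] Cor. 3.12; typed ≠ proved ≠ print.
-/

namespace Literature.GroupTheory.CombinatorialGroupTheory.FoxChain

/-! ### Fibre sums along an equivariant map `G → X` -/

section Fibre

variable {G : Type*} [Group G] [Fintype G] {X : Type*} [MulAction G X] [DecidableEq X] {k : Type*}

/-- Along a `G`-equivariant map `p : G → X` (`p (g y) = g • p y`) the fibre sum of a LEFT translate is the fibre
sum over the translated fibre: `(p_* (g·f)) (c) = (p_* f) (g⁻¹ • c)` (re-index `y ↦ g⁻¹ y`).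
[cite: LyndonSchupp2001, Ch. II §3] -/
theorem push_lt_apply_of_smul [AddCommMonoid k] (p : G → X) (hp : ∀ g y : G, p (g * y) = g • p y) (g : G)
    (f : G → k) (c : X) : push p (lt g f) c = push p f (g⁻¹ • c) := by
  simp only [push_apply, lt_apply]
  refine Finset.sum_nbij' (fun y => g⁻¹ * y) (fun y => g * y) ?_ ?_ ?_ ?_ ?_
  · intro y hy
    simp only [Finset.mem_filter, Finset.mem_univ, true_and] at hy ⊢
    rw [hp, hy]
  · intro y hy
    simp only [Finset.mem_filter, Finset.mem_univ, true_and] at hy ⊢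
    rw [hp, hy, smul_inv_smul]
  · intro y _; simp
  · intro y _; simp
  · intro y _; rfl

omit [MulAction G X] in
/-- Along `p : G → X`, the fibre sum is blind to RIGHT translation by any `h` acting trivially on the fibres
(`p (y h) = p y`): `p_* (f·h) = p_* f` (re-index `y ↦ y h⁻¹` inside each fibre). [cite: LyndonSchupp2001, Ch. II §3] -/
theorem push_rt_of_apply_mul [AddCommMonoid k] (p : G → X) {h : G} (hh : ∀ y : G, p (y * h) = p y)
    (f : G → k) : push p (rt h f) = push p f := by
  funext c
  simp only [push_apply, rt_apply]
  refine Finset.sum_nbij' (fun y => y * h⁻¹) (fun y => y * h) ?_ ?_ ?_ ?_ ?_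
  · intro y hy
    simp only [Finset.mem_filter, Finset.mem_univ, true_and] at hy ⊢
    rw [← hh (y * h⁻¹), inv_mul_cancel_right]
    exact hy
  · intro y hy
    simp only [Finset.mem_filter, Finset.mem_univ, true_and] at hy ⊢
    rw [hh, hy]
  · intro y _; simp
  · intro y _; simp
  · intro y _; rfl

/-- **Invariance of the pushed chain.**  If `θ - q·θ = φ - φ·h` with `h` acting trivially on the fibres of the
equivariant `p : G → X`, then `p_* θ` is `q`-INVARIANT: `(p_* θ)(q • c) = (p_* θ)(c)` (push both sides forward:
the right-hand side dies, the left-hand side is `p_* θ - (c ↦ (p_* θ)(q⁻¹ • c))`). [cite: LyndonSchupp2001, Ch. II §3] -/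
theorem push_apply_smul_eq_of_sub_lt_eq_sub_rt [AddCommGroup k] (p : G → X)
    (hp : ∀ g y : G, p (g * y) = g • p y) {h : G} (hh : ∀ y : G, p (y * h) = p y) {q : G} {θ φ : G → k}
    (hθ : θ - lt q θ = φ - rt h φ) (c : X) : push p θ (q • c) = push p θ c := by
  have h1 : push p θ = push p (lt q θ) := by
    rw [← sub_eq_zero, ← push_sub, hθ, push_sub, push_rt_of_apply_mul p hh, sub_self]
  have h2 := congrFun h1 (q • c)
  rw [push_lt_apply_of_smul p hp, inv_smul_smul] at h2
  exact h2

end Fibre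

/-! ### The chain `θ = e_1 + γ·(A - 1)` of an a-balanced Fox chain -/

section Chain

variable {G : Type*} [Group G] [DecidableEq G] {k : Type*} [CommRing k]

/-- If `(α, β)` satisfies the fundamental formula (c2) `α(A-1) + β(B-1) = q - 1` and `α = γ - q·γ`, then the chain
`θ := e_1 + γ·A - γ` satisfies `θ - q·θ = β - β·B` (substitute and compare: both sides of (c2) minus each other).
[cite: LyndonSchupp2001, Ch. II §3] -/
theorem sub_lt_eq_sub_rt_of_bd {A B q : G} {α β γ : G → k} (hc2 : rt A α - α + (rt B β - β) = e q - e 1)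
    (hα : α = γ - lt q γ) : (e 1 + (rt A γ - γ)) - lt q (e 1 + (rt A γ - γ)) = β - rt B β := by
  subst hα
  rw [rt_sub] at hc2
  rw [lt_add, lt_sub, lt_e, mul_one, lt_rt]
  linear_combination hc2

/-- The chain `θ = e_1 + γ·A - γ` has total coefficient sum `1` (`ε(γ·A) = ε(γ)`, `ε(e_1) = 1`).
[cite: LyndonSchupp2001, Ch. II §3] -/
theorem sum_e_one_add_rt_sub [Fintype G] (A : G) (γ : G → k) : ∑ y, (e 1 + (rt A γ - γ) : G → k) y = 1 := by
  have h : csum Finset.univ (e (1 : G) + (rt A γ - γ) : G → k) = 1 := by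
    rw [map_add, map_sub, csum_rt Finset.univ Finset.univ A (fun q => by simp) γ, sub_self, add_zero, csum_e,
      if_pos (Finset.mem_univ _)]
  simpa only [csum_apply] using h

end Chain

/-! ### The orbit criterion -/

section OrbitCriterion

variable {G : Type*} [Group G] [Finite G] [DecidableEq G] {k : Type*} [CommRing k]

/-- **The orbit criterion, coefficients killing `ℓ`.**  Let `G` be a finite group, `k` a NON-TRIVIAL commutative
ring with `(ℓ : k) = 0`, and `(α, β)` a Fox chain from `1` to `q` (`α(A-1) + β(B-1) = q - 1`, (c2)) that is
a-BALANCED: `N_q · α = 0`.  Then some `⟨q⟩`-orbit on the `b`-vertices `G/⟨B⟩` has length `d` prime to `ℓ`: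
`∃ g d, ¬ ℓ ∣ d ∧ g⁻¹ q^d g ∈ ⟨B⟩`.  Proof (PL2-SEP-PROOF-v2 Lemma 2′(⇒)): `α = γ - q·γ` (Brown (6.3),
`FoxChain.normL_eq_zero_iff`); the chain `θ = e_1 + γ·(A-1)` has mass `1` and `θ - qθ = β - βB`, so its push-forward
`ξ` to `G/⟨B⟩` is a `q`-invariant `0`-chain of mass `1`; were every `⟨q⟩`-orbit of length divisible by `ℓ`, the
orbit-count vanishing test (`FoxChain.sum_eq_zero_of_dvd_minimalPeriod`) would give `1 = Σ ξ = 0` in `k`.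
[cite: LyndonSchupp2001, Ch. II §3] -/
theorem exists_conj_pow_mem_zpowers_of_normL_eq_zero_of_natCast_eq_zero [Nontrivial k] {A B q : G}
    {α β : G → k} (hc2 : rt A α - α + (rt B β - β) = e q - e 1) (hbal : normL q α = 0) {ℓ : ℕ}
    (hℓ : (ℓ : k) = 0) : ∃ g : G, ∃ d : ℕ, ¬ ℓ ∣ d ∧ g⁻¹ * q ^ d * g ∈ Subgroup.zpowers B := by
  classical
  cases nonempty_fintype G
  -- (Gr): an a-balanced chain is a `q`-coboundary
  obtain ⟨γ, hγ⟩ := (normL_eq_zero_iff (isOfFinOrder_of_finite q) α).1 hbal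
  -- the `b`-vertices `G/⟨B⟩`, with `G` acting on the left
  set H : Subgroup G := Subgroup.zpowers B
  haveI : Fintype (G ⧸ H) := Fintype.ofFinite _
  have hp : ∀ g y : G, (QuotientGroup.mk (g * y) : G ⧸ H) = g • (QuotientGroup.mk y : G ⧸ H) :=
    fun g y => (MulAction.Quotient.smul_mk H g y).symm
  have hB : ∀ y : G, (QuotientGroup.mk (y * B) : G ⧸ H) = QuotientGroup.mk y := fun y =>
    QuotientGroup.eq.2 (by
      rw [mul_inv_rev, inv_mul_cancel_right]
      exact H.inv_mem (Subgroup.mem_zpowers B))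
  -- the `q`-invariant `0`-chain `ξ = p_* θ` of mass `1`
  set θ : G → k := e 1 + (rt A γ - γ)
  have hθ : θ - lt q θ = β - rt B β := sub_lt_eq_sub_rt_of_bd hc2 hγ
  have hinv : ∀ c : G ⧸ H,
      push (QuotientGroup.mk : G → G ⧸ H) θ (q • c) = push (QuotientGroup.mk : G → G ⧸ H) θ c :=
    push_apply_smul_eq_of_sub_lt_eq_sub_rt (QuotientGroup.mk : G → G ⧸ H) hp hB hθ
  have hsum : ∑ c : G ⧸ H, push (QuotientGroup.mk : G → G ⧸ H) θ c = 1 := by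
    rw [sum_push]
    exact sum_e_one_add_rt_sub A γ
  -- if every `⟨q⟩`-orbit had length divisible by `ℓ`, the mass would vanish
  by_contra hcon
  push Not at hcon
  have hτ : ⇑(MulAction.toPerm q : Equiv.Perm (G ⧸ H)) = fun c => q • c := rfl
  have hper : ∀ c ∈ (Finset.univ : Finset (G ⧸ H)),
      ℓ ∣ Function.minimalPeriod (MulAction.toPerm q : Equiv.Perm (G ⧸ H)) c := by
    intro c _
    rw [hτ]
    by_contra hd
    obtain ⟨g, rfl⟩ := QuotientGroup.mk_surjective c
    refine hcon g _ hd ?_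
    have hfix := (MulAction.pow_smul_eq_iff_minimalPeriod_dvd (a := q)
      (b := (QuotientGroup.mk g : G ⧸ H))).2 dvd_rfl
    rw [MulAction.Quotient.smul_mk, smul_eq_mul] at hfix
    have hmem := QuotientGroup.eq.1 hfix.symm
    rwa [← mul_assoc] at hmem
  have h0 := sum_eq_zero_of_dvd_minimalPeriod hℓ (MulAction.toPerm q : Equiv.Perm (G ⧸ H)) Finset.univ
    (fun c => by simp only [Finset.mem_univ]) (push (QuotientGroup.mk : G → G ⧸ H) θ)
    (fun c => by rw [hτ]; exact hinv c) hper
  rw [hsum] at h0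
  exact one_ne_zero h0

/-- **The orbit criterion** (PL2-SEP-PROOF-v2 Lemma 2′(⇒), finite coefficients).  Let `G` be a finite group, `k` a
commutative ring, `(α, β)` a Fox chain from `1` to `q` ((c2) `α(A-1) + β(B-1) = q - 1`) that is a-BALANCED
(`N_q · α = 0`), and `ℓ : ℕ` NOT A UNIT in `k` (the finite-coefficient form of «`ℓ` prime, `ℓ ∉ Ẑˣ`»; e.g.
`k = ZMod ℓ^e`, `e ≥ 1`).  Then some `⟨q⟩`-orbit on the `b`-vertices `G/⟨B⟩` has length prime to `ℓ`, i.e.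
`∃ g d, ¬ ℓ ∣ d ∧ g⁻¹ q^d g ∈ ⟨B⟩` — equivalently the `ℓ`-Sylow subgroup of `⟨q⟩` fixes the `b`-vertex `g⟨B⟩`
(base change to the non-trivial ring `k/(ℓ)`, then `exists_conj_pow_mem_zpowers_of_normL_eq_zero_of_natCast_eq_zero`).
[cite: LyndonSchupp2001, Ch. II §3] -/
theorem exists_conj_pow_mem_zpowers_of_normL_eq_zero {A B q : G} {α β : G → k}
    (hc2 : rt A α - α + (rt B β - β) = e q - e 1) (hbal : normL q α = 0) {ℓ : ℕ} (hℓ : ¬ IsUnit (ℓ : k)) :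
    ∃ g : G, ∃ d : ℕ, ¬ ℓ ∣ d ∧ g⁻¹ * q ^ d * g ∈ Subgroup.zpowers B := by
  set I : Ideal k := Ideal.span {(ℓ : k)}
  haveI : Nontrivial (k ⧸ I) := Ideal.Quotient.nontrivial_iff.2 (Ideal.span_singleton_ne_top hℓ)
  have hℓ' : ((ℓ : ℕ) : k ⧸ I) = 0 := by
    rw [← map_natCast (Ideal.Quotient.mk I), Ideal.Quotient.eq_zero_iff_mem]
    exact Ideal.mem_span_singleton_self _
  set σ : k →+* k ⧸ I := Ideal.Quotient.mk I
  have hc2' : rt A (σ ∘ α) - σ ∘ α + (rt B (σ ∘ β) - σ ∘ β) = e q - e 1 := by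
    funext x
    have hx := congrArg σ (congrFun hc2 x)
    simp only [Pi.add_apply, Pi.sub_apply, rt_apply, e, map_add, map_sub, apply_ite σ, map_one,
      map_zero] at hx
    simp only [Pi.add_apply, Pi.sub_apply, rt_apply, Function.comp_apply, e]
    exact hx
  have hbal' : normL q (σ ∘ α) = 0 := by
    funext x
    have hx := congrArg σ (congrFun hbal x)
    rw [Pi.zero_apply, map_zero, normL_apply, map_sum] at hx
    rw [Pi.zero_apply, normL_apply]
    exact hx
  exact exists_conj_pow_mem_zpowers_of_normL_eq_zero_of_natCast_eq_zero hc2' hbal' hℓ'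

omit [Finite G] [DecidableEq G] in
/-- Bezout: if `q^d ∈ K` with `d` prime to `n`, every `x ∈ ⟨q⟩` with `x^n = 1` lies in `K`
(`x = (x^d)^u (x^n)^v` for `u d + v n = 1`, and `x^d ∈ ⟨q^d⟩ ≤ K`). [folklore] -/
private theorem mem_of_pow_mem_of_coprime {K : Subgroup G} {q : G} {d n : ℕ} (hd : q ^ d ∈ K) (hdn : d.Coprime n)
    {x : G} (hx : x ∈ Subgroup.zpowers q) (hxn : x ^ n = 1) : x ∈ K := by
  obtain ⟨i, rfl⟩ := Subgroup.mem_zpowers_iff.1 hx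
  obtain ⟨u, v, huv⟩ := Nat.isCoprime_iff_coprime.2 hdn
  have hxd : (q ^ i) ^ (d : ℤ) = (q ^ d) ^ i := by
    rw [← zpow_natCast q d, ← zpow_mul, ← zpow_mul, mul_comm]
  have key : q ^ i = ((q ^ d) ^ i) ^ u := by
    calc q ^ i = (q ^ i) ^ (u * d + v * n : ℤ) := by rw [huv, zpow_one]
      _ = ((q ^ i) ^ (d : ℤ)) ^ u * ((q ^ i) ^ (n : ℤ)) ^ v := by
          rw [zpow_add, mul_comm u, zpow_mul, mul_comm v, zpow_mul]
      _ = ((q ^ d) ^ i) ^ u := by rw [hxd, zpow_natCast, hxn, one_zpow, mul_one]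
  rw [key]
  exact K.zpow_mem (K.zpow_mem hd i) u

/-- **The orbit criterion, primary-part form.**  Under the hypotheses of
`exists_conj_pow_mem_zpowers_of_normL_eq_zero` with `ℓ` PRIME, ONE element `g` conjugates every element of `⟨q⟩` of
`ℓ`-power order — in particular the `ℓ`-primary part `q_ℓ` of `q` — into `⟨B⟩`: «`q_ℓ` fixes the `b`-vertex
`g⟨B⟩`» (PL2-SEP-PROOF-v2 Lemma 2′(⇒), second clause). [cite: LyndonSchupp2001, Ch. II §3] -/
theorem exists_forall_conj_mem_zpowers_of_normL_eq_zero {A B q : G} {α β : G → k}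
    (hc2 : rt A α - α + (rt B β - β) = e q - e 1) (hbal : normL q α = 0) {ℓ : ℕ} (hprime : ℓ.Prime)
    (hℓ : ¬ IsUnit (ℓ : k)) :
    ∃ g : G, ∀ x ∈ Subgroup.zpowers q, ∀ j : ℕ, x ^ ℓ ^ j = 1 → g⁻¹ * x * g ∈ Subgroup.zpowers B := by
  obtain ⟨g, d, hd, hmem⟩ := exists_conj_pow_mem_zpowers_of_normL_eq_zero hc2 hbal hℓ
  refine ⟨g, fun x hx j hj => ?_⟩
  -- `K = g ⟨B⟩ g⁻¹`, the stabiliser of the `b`-vertex `g⟨B⟩`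
  set K : Subgroup G := (Subgroup.zpowers B).comap (MulAut.conj g⁻¹).toMonoidHom with hK
  have hmemK : ∀ y : G, y ∈ K ↔ g⁻¹ * y * g ∈ Subgroup.zpowers B := fun y => by
    rw [hK, Subgroup.mem_comap, MulEquiv.coe_toMonoidHom, MulAut.conj_apply, inv_inv]
  have hqd : q ^ d ∈ K := (hmemK _).2 hmem
  exact (hmemK x).1 (mem_of_pow_mem_of_coprime hqd ((hprime.coprime_iff_not_dvd.2 hd).symm.pow_right j) hx hj)

omit [DecidableEq G] in
/-- In a finite group, `g⁻¹ x g ∈ ⟨B⟩` implies `x = g B^n g⁻¹` for some `n : ℕ`. [folklore] -/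
private theorem exists_eq_conj_pow_of_conj_mem_zpowers {B g x : G} (h : g⁻¹ * x * g ∈ Subgroup.zpowers B) :
    ∃ n : ℕ, x = g * B ^ n * g⁻¹ := by
  obtain ⟨n, hn⟩ := ((isOfFinOrder_of_finite B).mem_powers_iff_mem_zpowers).2 h
  have hn' : B ^ n = g⁻¹ * x * g := hn
  refine ⟨n, ?_⟩
  rw [hn']
  group

/-- `ℓ` is not a unit of `ZMod n` when `1 < ℓ ∣ n` (e.g. `n = ℓ^e`, `e ≥ 1`). [folklore] -/
private theorem not_isUnit_natCast_zmod_of_dvd {ℓ n : ℕ} (h1 : 1 < ℓ) (hn : ℓ ∣ n) : ¬ IsUnit ((ℓ : ℕ) : ZMod n) := by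
  rw [ZMod.isUnit_iff_coprime]
  exact fun h => absurd (h.eq_one_of_dvd hn) h1.ne'

end OrbitCriterion

end Literature.GroupTheory.CombinatorialGroupTheory.FoxChain

/-! ### The leaf (BAL) at a level of `F̂₂` -/

noncomputable section

namespace Literature.AnabelianGeometry.EtaleTheta.SettingModel.FoxLevel

open Literature.GroupTheory.CombinatorialGroupTheory.FoxChain

variable {G : Type} [Group G] [Finite G] [DecidableEq G] {k : Type} [CommRing k] [Finite k]

/-- a-BALANCE of `w ∈ F̂₂` at the level `(G, k, A, B)`: `α_{w ^ ord(π w)} = N_{π w} · α_w` ((c3) `FoxLevel.alpha_pow`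
with `j = ord(π w)`), so «`α_{w ^ ord(π w)} = 0`» and «`N_{π w} · α_w = 0`» are the same condition.
[cite: LyndonSchupp2001, Ch. II §3] -/
theorem alpha_pow_orderOf_lev (A B : G) (w : F₂hatT) :
    alpha (k := k) A B (w ^ orderOf (lev A B w)) = normL (lev A B w) (alpha A B w) := by
  rw [normL]
  exact alpha_pow A B w _

/-- **(BAL) — the orbit criterion at a level of `F̂₂`** (PL2-SEP-PROOF-v2 Lemma 2′(⇒) for OUR model, finite
coefficients).  If the level-`(G, k, A, B)` Fox chain of `w ∈ F̂₂` is a-BALANCED, `N_{π w} · α_w = 0`, and `ℓ : ℕ`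
is not a unit of `k`, then some power `(π w)^d` with `ℓ ∤ d` is `G`-conjugate into `⟨B⟩` — the `ℓ`-Sylow subgroup of
`⟨π w⟩` fixes a `b`-vertex `g⟨B⟩` of the level-`G` coset graph ((c2) `FoxLevel.alpha_bd` BY NAME +
`FoxChain.exists_conj_pow_mem_zpowers_of_normL_eq_zero`). [cite: MochizukiEtTh2009, §1 p.12] -/
theorem exists_conj_lev_pow_mem_zpowers_of_normL_eq_zero (A B : G) (w : F₂hatT)
    (hbal : normL (lev A B w) (alpha (k := k) A B w) = 0) {ℓ : ℕ} (hℓ : ¬ IsUnit (ℓ : k)) :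
    ∃ g : G, ∃ d : ℕ, ¬ ℓ ∣ d ∧ g⁻¹ * lev A B w ^ d * g ∈ Subgroup.zpowers B :=
  exists_conj_pow_mem_zpowers_of_normL_eq_zero (alpha_bd A B w) hbal hℓ

/-- **(BAL)**, hypothesis spelled `α_{w ^ ord(π w)} = 0`. [cite: MochizukiEtTh2009, §1 p.12] -/
theorem exists_conj_lev_pow_mem_zpowers_of_alpha_pow_eq_zero (A B : G) (w : F₂hatT)
    (hbal : alpha (k := k) A B (w ^ orderOf (lev A B w)) = 0) {ℓ : ℕ} (hℓ : ¬ IsUnit (ℓ : k)) :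
    ∃ g : G, ∃ d : ℕ, ¬ ℓ ∣ d ∧ g⁻¹ * lev A B w ^ d * g ∈ Subgroup.zpowers B :=
  exists_conj_lev_pow_mem_zpowers_of_normL_eq_zero A B w (by rw [← alpha_pow_orderOf_lev]; exact hbal) hℓ

/-- **(BAL), primary-part form** (the clause Theorem A consumes): for `ℓ` PRIME and not a unit of `k`, if the
level Fox chain of `w` is a-balanced then ONE `g ∈ G` exhibits every `ℓ`-power-order element `x` of `⟨π w⟩` — in
particular the image `π(w_ℓ)` of the `ℓ`-primary component of `w` — as `x = g B^n g⁻¹`, i.e. conjugate INTO the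
cyclic group generated by `B = π b` (the shape of `SettingModel.exists_eq_conj_bPow_of_forall_quotient`).
[cite: MochizukiEtTh2009, §1 p.12] -/
theorem exists_forall_eq_conj_pow_of_normL_eq_zero (A B : G) (w : F₂hatT)
    (hbal : normL (lev A B w) (alpha (k := k) A B w) = 0) {ℓ : ℕ} (hprime : ℓ.Prime) (hℓ : ¬ IsUnit (ℓ : k)) :
    ∃ g : G, ∀ x ∈ Subgroup.zpowers (lev A B w), ∀ j : ℕ, x ^ ℓ ^ j = 1 → ∃ n : ℕ, x = g * B ^ n * g⁻¹ := by
  obtain ⟨g, hg⟩ := exists_forall_conj_mem_zpowers_of_normL_eq_zero (alpha_bd A B w) hbal hprime hℓ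
  exact ⟨g, fun x hx j hj => exists_eq_conj_pow_of_conj_mem_zpowers (hg x hx j hj)⟩

/-- **(BAL) with coefficients `ZMod n`, `1 < ℓ ∣ n`** (e.g. `n = ℓ^e`: the coefficient rings in which row (T⇒E)
delivers a-balance prime by prime). [cite: MochizukiEtTh2009, §1 p.12] -/
theorem exists_conj_lev_pow_mem_zpowers_of_normL_eq_zero_zmod {n : ℕ} [NeZero n] (A B : G) (w : F₂hatT)
    (hbal : normL (lev A B w) (alpha (k := ZMod n) A B w) = 0) {ℓ : ℕ} (h1 : 1 < ℓ) (hn : ℓ ∣ n) :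
    ∃ g : G, ∃ d : ℕ, ¬ ℓ ∣ d ∧ g⁻¹ * lev A B w ^ d * g ∈ Subgroup.zpowers B :=
  exists_conj_lev_pow_mem_zpowers_of_normL_eq_zero A B w hbal (not_isUnit_natCast_zmod_of_dvd h1 hn)

/-- **(BAL), primary-part form with coefficients `ZMod n`**, `ℓ` prime, `ℓ ∣ n`. [cite: MochizukiEtTh2009, §1 p.12] -/
theorem exists_forall_eq_conj_pow_of_normL_eq_zero_zmod {n : ℕ} [NeZero n] (A B : G) (w : F₂hatT)
    (hbal : normL (lev A B w) (alpha (k := ZMod n) A B w) = 0) {ℓ : ℕ} (hprime : ℓ.Prime) (hn : ℓ ∣ n) :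
    ∃ g : G, ∀ x ∈ Subgroup.zpowers (lev A B w), ∀ j : ℕ, x ^ ℓ ^ j = 1 → ∃ m : ℕ, x = g * B ^ m * g⁻¹ :=
  exists_forall_eq_conj_pow_of_normL_eq_zero A B w hbal hprime
    (not_isUnit_natCast_zmod_of_dvd hprime.one_lt hn)

end Literature.AnabelianGeometry.EtaleTheta.SettingModel.FoxLevel

end
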